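import Summits.QuantumFields.YangMills.Theorems.BalabanUVNodesN07DbarFrameTowerBridge
import Literature.MathematicalPhysics.QuantumFieldTheory.Balaban1983to89.BlockAveragingPlaquetteBound
import HarnessLib

/-!
# N07 [B11] (= [15] = [Balaban1985Variational]) Sect. F — plan g93 WORD A3⁵ = ρ3, (c-iii) part 1: **THE LETTERS OF THE (L1″) FRAME BRIDGE FROM ONE STAIR LETTER** — generic `P`, `N ≥ 1`,
# any averaging family `av`, any fine field `U₁`, any «good» region closed under centres and block sites: if the centre stairs of `M^i(U₁)` in the good blocks are within `σ_i` of `1`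
# (`2σ_i <` Federbush's radius), then the stair families are Federbush-small (`hfam`), within `p_i := 8σ_i` of their mean (`hP`), print's sheared frames `S_i(U₁)` ([3] (85), averaged
# contour datum of [I] (0.11)) are within `s_i` of `1` on good sites and the sheared one-block family is within `t_i := 7σ_i + 2s_i` of `1` (`hY`), for ANY majorants `s`, `t` closing the
# recursion `s_0 ≥ 0`, `s_i + 2t_i + 8t_i² ≤ s_{i+1}` — exactly the hypotheses `hfam`, `hP`, `hY` of `…N07DbarFrameTowerBridge.norm_accFrame_sub_shearRIter_le`

Cell `pub-ymgap`, seat `pub-ymgap-dag-n07-e` g30 (FAN-OUT §N07 row s3; LANE OWNER of the K0 road chart side).  `--kind proof --supports stmt-QuantumFields-20541 --as helper` (K0⁷);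
count-neutral; THEOREMS ONLY (0 `def`).  [3] = [Balaban1985Averaging]; [I] = [Balaban1987RG1]; [15] = [Balaban1985Variational].

WHY.  (L1″) (`norm_accFrame_sub_shearRIter_le`, ✓p741747) bounds `‖V_i − S_i‖ ≤ φ_i` from per-level letters `p`, `t`, `φ` and three structural hypotheses on the stair families of
`M^i(U₁)` at good sites.  At the record (`U₁ := U^u`, the Landau copy) the ONLY analytic input is a bound on the level-`i` bonds of `M^i(U^u)` inside good blocks (UST's flat reads
`norm_emlIterU_sub_one_le_of_reads` + the dictionary), whence a stair letter `σ_i` (`Prop8ChartDoubleBar.norm_holT_stair_sub_one_le`).  This file turns `σ` into `hfam`, `hP`, `hY` by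
unitary bookkeeping: Federbush's mean is `3·(2σ)`-close to the base member (`federbushSU_dist1_le`), `exp[mean log]` of a `t`-small family is `(2t + 8t²)`-close to `1` ([3] (26)–(27),
`norm_eml_sub_one_le`; off the guard the tree's `ESU` is `1`), and `S_{i+1}(y) = S_i(ȳ)·𝓔_y{S_i(ȳ)⁻¹·𝐔·S_i(x)}` (definitional) gives the recursion for `s`.  Crude (first-order) letters
suffice: (L1″)'s error is third order in `(p, t, φ)` except the conjugating-frame term `64(t+φ)²`, and `Σ_i t_i²` is geometric at the record.

WHAT IS PROVED (sorry-free; axioms standard).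
* §1 unitary bookkeeping on `SU(N) ⊂ M_N(ℂ)` (operator norm): `norm_coe_inv_mul_mul_sub_one_eq` (`‖a⁻¹bc − 1‖ = ‖bc − a‖`), `norm_coe_mul_sub_one_le` ∕ `norm_mul_coe_sub_one_le`
  (`‖bc − 1‖ ≤ ‖b − 1‖ + ‖c − 1‖`), `norm_sub_eq_norm_mul_star_sub_one`.
* §2 Federbush: `familySmall_of_norm_le` (`‖W_k − 1‖ ≤ σ`, `2σ < δ_F` ⇒ `FamilySmall δ_F W`), ★ `norm_coe_fedM_sub_one_le` (`‖M(W) − 1‖ ≤ 7σ`), ★ `norm_mul_star_fedM_sub_one_le` (`‖W_k·M(W)* − 1‖ ≤ 8σ`).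
* §3 `exp[mean log]`: ★ `norm_coe_avg_sub_one_le` (`‖𝓔{W} − 1‖ ≤ 2t + 8t²` for a `t`-small `SU(N)` family, `t ≤ ½`, EITHER branch of the guard).
* §4 ★★★ `norm_shearRIter_sub_one_le` (the `s`-recursion by induction on the level, generic good region) and ★★★ `sheared_family_letters` — the three hypotheses `hfam`, `hP` (`p_i := 8σ_i`),
  `hY` (`t_i`) of (L1″) in its exact binder shapes, from the stair letter `σ` and the majorants `s`, `t`.
HONEST SCOPE: norm bookkeeping; nothing of [15]∕[3]∕[I] analysis asserted; nothing instantiated at the record here (part 2 `…N07DbarFrameTowerAtRecord`); K0⁷ NOT closed; N07 NOT discharged;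
counts unmoved; one finite 𝕋⁴ programme at fixed ε — the route closes the conditional finite-𝕋⁴ rung `BalabanLadder.UV` ONLY; the YM mass gap (Clay) is NOT proved by any of this; nothing
continuum ∕ ℝ⁴ ∕ OS.  No `def`, no `instance`, no `notation`, no `sorry`.

References: [3] (26)–(27) p. 22, (78) p. 30, (85) p. 31, (110) p. 34; [I] (0.3)–(0.11) pp. 252–253; [15] (150)–(154) pp. 301–302.
-/

set_option autoImplicit false

noncomputable section

open scoped BigOperators Matrix.Norms.L2Operator

namespace Summit.QuantumFields.YangMills.BalabanUVNodes.N07ShearedFrameLetters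

open Literature.MathematicalPhysics.QuantumFieldTheory.Balaban1983to89
open Literature.MathematicalPhysics.QuantumFieldTheory.Balaban1983to89.Node00
open MatrixLog ExpMeanLog FederbushMean
open Summit.QuantumFields.YangMills.BalabanUVNodes.N07SymContourData (stairFamily symContourData symContourData_holTo_of_small)
open Literature.MathematicalPhysics.QuantumFieldTheory.Balaban1983to89.BlockAveragingEMLProp2 (coe_avg_eq_eml)
open Literature.MathematicalPhysics.QuantumFieldTheory.Balaban1983to89.BlockAveragingPlaquetteBound (norm_eml_sub_one_le)

variable {P : Params} {N : ℕ} [NeZero N]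

/-! ## §1  Unitary bookkeeping on `SU(N) ⊂ M_N(ℂ)` -/

section Unitary

omit [NeZero N] in
/-- The value of an `SU(N)` element is a unitary matrix. [cite: Balaban1985Averaging, (110) p.34 (bookkeeping)] -/
theorem coe_mem_unitary (a : SU N) : (a : Matrix (Fin N) (Fin N) ℂ) ∈ Matrix.unitaryGroup (Fin N) ℂ :=
  Matrix.specialUnitaryGroup_le_unitaryGroup a.2
set_option maxHeartbeats 400000 in
omit [NeZero N] in
/-- `‖a⁻¹·b·c − 1‖ = ‖b·c − a‖` in `SU(N)` read in `M_N(ℂ)`. [cite: Balaban1985Averaging, (110) p.34 (bookkeeping)] -/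
theorem norm_coe_inv_mul_mul_sub_one_eq (a b c : SU N) :
    ‖((a⁻¹ * b * c : SU N) : Matrix (Fin N) (Fin N) ℂ) - 1‖ = ‖((b * c : SU N) : Matrix (Fin N) (Fin N) ℂ) - (a : Matrix (Fin N) (Fin N) ℂ)‖ := by
  have h1 : ((a⁻¹ * b * c : SU N) : Matrix (Fin N) (Fin N) ℂ) - 1 =
      ((a⁻¹ : SU N) : Matrix (Fin N) (Fin N) ℂ) * (((b * c : SU N) : Matrix (Fin N) (Fin N) ℂ) - (a : Matrix (Fin N) (Fin N) ℂ)) := by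
    rw [mul_sub, ← Submonoid.coe_mul, ← Submonoid.coe_mul, inv_mul_cancel, OneMemClass.coe_one, mul_assoc]
  rw [h1, CStarRing.norm_mem_unitary_mul _ (coe_mem_unitary _)]

omit [NeZero N] in
/-- `‖b·c − 1‖ ≤ ‖b − 1‖ + ‖c − 1‖` in `SU(N)` read in `M_N(ℂ)` with the OPERATOR norm (exact, no product term; the tree's homonyms for plain matrices are Frobenius-norm statements).
[cite: Balaban1985Averaging, (110) p.34 (bookkeeping)] -/
theorem norm_coe_mul_sub_one_le (b c : SU N) :
    ‖((b * c : SU N) : Matrix (Fin N) (Fin N) ℂ) - 1‖ ≤ ‖(b : Matrix (Fin N) (Fin N) ℂ) - 1‖ + ‖(c : Matrix (Fin N) (Fin N) ℂ) - 1‖ := by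
  have h1 : ((b * c : SU N) : Matrix (Fin N) (Fin N) ℂ) - 1 =
      (b : Matrix (Fin N) (Fin N) ℂ) * ((c : Matrix (Fin N) (Fin N) ℂ) - 1) + ((b : Matrix (Fin N) (Fin N) ℂ) - 1) := by
    rw [Submonoid.coe_mul]; noncomm_ring
  rw [h1]
  refine (norm_add_le _ _).trans ?_
  rw [CStarRing.norm_mem_unitary_mul _ (coe_mem_unitary b), add_comm]

omit [NeZero N] in
/-- `‖X·w − 1‖ ≤ ‖X − 1‖ + ‖w − 1‖` for `w ∈ SU(N)` on the right, OPERATOR norm. [cite: Balaban1985Averaging, (110) p.34 (bookkeeping)] -/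
theorem norm_mul_coe_sub_one_le (X : Matrix (Fin N) (Fin N) ℂ) (w : SU N) :
    ‖X * (w : Matrix (Fin N) (Fin N) ℂ) - 1‖ ≤ ‖X - 1‖ + ‖(w : Matrix (Fin N) (Fin N) ℂ) - 1‖ := by
  have h1 : X * (w : Matrix (Fin N) (Fin N) ℂ) - 1 = (X - 1) * (w : Matrix (Fin N) (Fin N) ℂ) + ((w : Matrix (Fin N) (Fin N) ℂ) - 1) := by noncomm_ring
  rw [h1]
  refine (norm_add_le _ _).trans ?_
  rw [CStarRing.norm_mul_mem_unitary _ (coe_mem_unitary w)]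

omit [NeZero N] in
/-- `‖W − F‖ = ‖W·F* − 1‖` for `F` unitary. [cite: Balaban1985Averaging, (110) p.34 (bookkeeping)] -/
theorem norm_sub_eq_norm_mul_star_sub_one (W : Matrix (Fin N) (Fin N) ℂ) {F : Matrix (Fin N) (Fin N) ℂ} (hF : F ∈ Matrix.unitaryGroup (Fin N) ℂ) :
    ‖W - F‖ = ‖W * star F - 1‖ := by
  have h1 : W * star F - 1 = (W - F) * star F := by
    rw [sub_mul, Unitary.mul_star_self_of_mem hF]
  rw [h1, CStarRing.norm_mul_mem_unitary _ (Unitary.star_mem hF)]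

end Unitary

/-! ## §2  Federbush's mean of a `σ`-small stair family -/

section Federbush

variable {m : ℕ}
set_option maxHeartbeats 400000 in
/-- `dist1 (W_i·W_k⁻¹) = ‖W_i − W_k‖ ≤ 2σ`. [cite: Balaban1987RG1, (0.5)–(0.7) p.253 (bookkeeping)] -/
theorem dist1_mul_inv_le (W : Fin (m + 1) → SU N) {σ : ℝ} (hW : ∀ k, ‖(W k : Matrix (Fin N) (Fin N) ℂ) - 1‖ ≤ σ) (i k : Fin (m + 1)) :
    dist1 (W i * (W k)⁻¹) ≤ 2 * σ := by
  rw [dist1_SU_eq]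
  have h1 : ((W i * (W k)⁻¹ : SU N) : Matrix (Fin N) (Fin N) ℂ) - 1 =
      (((W i : Matrix (Fin N) (Fin N) ℂ) - 1) - ((W k : Matrix (Fin N) (Fin N) ℂ) - 1)) * (((W k)⁻¹ : SU N) : Matrix (Fin N) (Fin N) ℂ) := by
    rw [sub_sub_sub_cancel_right, sub_mul, ← Submonoid.coe_mul, ← Submonoid.coe_mul, mul_inv_cancel, OneMemClass.coe_one]
  rw [h1, CStarRing.norm_mul_mem_unitary _ (coe_mem_unitary _)]
  refine (norm_sub_le _ _).trans ?_
  linarith [hW i, hW k]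

/-- ★ A `σ`-small family with `2σ <` Federbush's radius is Federbush-small. [cite: Balaban1987RG1, (0.5)–(0.7) p.253] -/
theorem familySmall_of_norm_le (W : Fin (m + 1) → SU N) {σ : ℝ} (hW : ∀ k, ‖(W k : Matrix (Fin N) (Fin N) ℂ) - 1‖ ≤ σ)
    (hσ : 2 * σ < (federbushSU (n := Fin N)).δ) : FamilySmall (federbushSU (n := Fin N)).δ W :=
  fun i k => (dist1_mul_inv_le W hW i k).trans_lt hσ

/-- ★ **FEDERBUSH's MEAN OF A `σ`-SMALL FAMILY IS WITHIN `7σ` OF `1`** (`3·(2σ)` to the base member by `federbushSU_dist1_le`, `+ σ`). [cite: Balaban1987RG1, (0.10)–(0.11) p.253] -/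
theorem norm_coe_fedM_sub_one_le (W : Fin (m + 1) → SU N) {σ : ℝ} (hW : ∀ k, ‖(W k : Matrix (Fin N) (Fin N) ℂ) - 1‖ ≤ σ)
    (hσ : 2 * σ < (federbushSU (n := Fin N)).δ) :
    ‖(((federbushSU (n := Fin N)).M W : SU N) : Matrix (Fin N) (Fin N) ℂ) - 1‖ ≤ 7 * σ := by
  have hsmall := familySmall_of_norm_le W hW hσ
  have h2σ : 2 * σ ≤ 1 / 100 := (le_of_lt hσ).trans (by rw [federbushSU_δ]; exact deltaFed_le)
  have h3 : dist1 ((federbushSU (n := Fin N)).M W * (W 0)⁻¹) ≤ 3 * (2 * σ) :=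
    federbushSU_dist1_le hsmall h2σ fun j => dist1_mul_inv_le W hW j 0
  rw [dist1_SU_eq] at h3
  have h4 : (((federbushSU (n := Fin N)).M W : SU N) : Matrix (Fin N) (Fin N) ℂ) =
      (((federbushSU (n := Fin N)).M W * (W 0)⁻¹ : SU N) : Matrix (Fin N) (Fin N) ℂ) * (W 0 : Matrix (Fin N) (Fin N) ℂ) := by
    rw [← Submonoid.coe_mul, inv_mul_cancel_right]
  rw [h4]
  refine (norm_mul_coe_sub_one_le _ _).trans ?_
  linarith [hW 0]

/-- ★ **EVERY MEMBER IS WITHIN `8σ` OF THE MEAN**: `‖W_k·M(W)* − 1‖ ≤ 8σ` — (L1″)'s hypothesis `hP` with `p := 8σ`. [cite: Balaban1987RG1, (0.10)–(0.11) p.253; Balaban1985Averaging, (110) p.34] -/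
theorem norm_mul_star_fedM_sub_one_le (W : Fin (m + 1) → SU N) {σ : ℝ} (hW : ∀ k, ‖(W k : Matrix (Fin N) (Fin N) ℂ) - 1‖ ≤ σ)
    (hσ : 2 * σ < (federbushSU (n := Fin N)).δ) (k : Fin (m + 1)) :
    ‖(W k : Matrix (Fin N) (Fin N) ℂ) * star (((federbushSU (n := Fin N)).M W : SU N) : Matrix (Fin N) (Fin N) ℂ) - 1‖ ≤ 8 * σ := by
  rw [← norm_sub_eq_norm_mul_star_sub_one _ (coe_mem_unitary _)]
  have h1 : (W k : Matrix (Fin N) (Fin N) ℂ) - (((federbushSU (n := Fin N)).M W : SU N) : Matrix (Fin N) (Fin N) ℂ) =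
      ((W k : Matrix (Fin N) (Fin N) ℂ) - 1) - ((((federbushSU (n := Fin N)).M W : SU N) : Matrix (Fin N) (Fin N) ℂ) - 1) := by abel
  rw [h1]
  refine (norm_sub_le _ _).trans ?_
  linarith [hW k, norm_coe_fedM_sub_one_le W hW hσ]

end Federbush

/-! ## §3  `exp[mean log]` of a `t`-small `SU(N)` family -/

/-- ★ **`‖𝓔{W} − 1‖ ≤ 2t + 8t²`** for an `SU(N)` family with `‖W_i − 1‖ ≤ t ≤ ½`: on the guard the tree's `avg` is `exp[mean log]` ([3] (26)–(27): `≤ 2t·e^{2t} ≤ 2t(1 + 4t)`), off the guard it is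
`1`. [cite: Balaban1985Averaging, (26)–(27) p.22; Balaban1987RG1, (0.4) p.253] -/
theorem norm_coe_avg_sub_one_le {ι : Type*} [Fintype ι] [Nonempty ι] (W : ι → SU N) {t : ℝ} (hW : ∀ i, ‖(W i : Matrix (Fin N) (Fin N) ℂ) - 1‖ ≤ t) (ht : t ≤ 1 / 2) :
    ‖(((expMeanLogSU (n := Fin N)).avg W : SU N) : Matrix (Fin N) (Fin N) ℂ) - 1‖ ≤ 2 * t + 8 * t ^ 2 := by
  have ht0 : 0 ≤ t := (norm_nonneg _).trans (hW (Classical.arbitrary ι))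
  by_cases hsm : ∀ i, dist1 (W i) < deltaSU (Fin N)
  · rw [coe_avg_eq_eml _ hsm]
    refine (norm_eml_sub_one_le (W := fun i => (W i : Matrix (Fin N) (Fin N) ℂ)) hW ht).trans ?_
    have hexp : Real.exp (2 * t) ≤ 1 + 4 * t := by
      have h2t : |2 * t| = 2 * t := abs_of_nonneg (by linarith)
      have h := Real.abs_exp_sub_one_le (x := 2 * t) (by rw [h2t]; linarith)
      rw [h2t] at h
      have := (abs_le.mp h).2
      linarith
    nlinarith
  · have havg : (expMeanLogSU (n := Fin N)).avg W = 1 := by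
      unfold LoopAverage.avg
      apply ESU_of_not_small
      intro h
      exact hsm fun i => by
        have := h ((LoopAverage.enum ι) i)
        simpa [Function.comp, dist1_SU_eq] using this
    rw [havg, OneMemClass.coe_one, sub_self, norm_zero]
    positivity

/-! ## §4  The sheared frames and the three letters of (L1″) -/

section Letters

variable (av : ∀ i, Averaging P i (SU N)) (U₁ : GaugeField P 0 (SU N)) (good : (i : ℕ) → Site P i → Prop) (l : ℕ)

/-- ★★★ **PRINT's SHEARED FRAMES ARE WITHIN `s_i` OF `1` ON GOOD SITES** ([3] (85) `shearRIter` for the averaged contour datum and `exp[mean log]`): from the stair letter `σ` on good blocks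
(`2σ_i <` Federbush's radius) and ANY majorants with `0 ≤ s_0`, `7σ_i + 2s_i ≤ t_i ≤ ½`, `s_i + 2t_i + 8t_i² ≤ s_{i+1}` (`i < l ≤ m+K`); the good region closed under centres and block sites.
Induction on the level: `S_{i+1}(y) = S_i(ȳ)·𝓔_y{S_i(ȳ)⁻¹·M(stairs)·S_i(x)}`, each member within `7σ_i + 2s_i` of `1` (§2, §1), the block operation within `2t_i + 8t_i²` (§3).
[cite: Balaban1985Averaging, (85) p.31, (26)–(27) p.22; Balaban1987RG1, (0.11) p.253] -/
theorem norm_shearRIter_sub_one_le (hl : l ≤ P.m + P.K)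
    (hgood_emb : ∀ i, i < l → ∀ y : Site P (i + 1), good (i + 1) y → good i (emb y))
    (hgood_block : ∀ i, i < l → ∀ y : Site P (i + 1), good (i + 1) y → ∀ r : Fin P.d → Fin P.L, good i (Site.blockSite y r))
    (σ s t : ℕ → ℝ)
    (hσ : ∀ i, i < l → ∀ y : Site P (i + 1), good (i + 1) y → ∀ (r : Fin P.d → Fin P.L) (k : Fin ((Nat.factorial P.d - 1) + 1)),
      ‖((stairFamily (Averaging.iter av i U₁) y r k : SU N) : Matrix (Fin N) (Fin N) ℂ) - 1‖ ≤ σ i)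
    (hσδ : ∀ i, i < l → 2 * σ i < (federbushSU (n := Fin N)).δ)
    (hs0 : 0 ≤ s 0) (hst : ∀ i, i < l → 7 * σ i + 2 * s i ≤ t i) (ht2 : ∀ i, i < l → t i ≤ 1 / 2)
    (hss : ∀ i, i < l → s i + (2 * t i + 8 * t i ^ 2) ≤ s (i + 1)) :
    ∀ i, i ≤ l → ∀ z : Site P i, good i z →
      ‖((shearRIter av (fun _ => symContourData (federbushSU (n := Fin N))) (loopAvgBlockOp expMeanLogSU) U₁ i z : SU N) : Matrix (Fin N) (Fin N) ℂ) - 1‖ ≤ s i := by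
  intro i
  induction i with
  | zero =>
    intro _ z _
    show ‖((1 : SU N) : Matrix (Fin N) (Fin N) ℂ) - 1‖ ≤ s 0
    rw [OneMemClass.coe_one, sub_self, norm_zero]
    exact hs0
  | succ i ih =>
    intro hi1 y hy
    have hi : i < l := Nat.lt_of_succ_le hi1
    have hiK : i + 1 ≤ P.m + P.K := hi1.trans hl
    have ih' := ih hi.le
    -- `S_{i+1}(y) = S_i(ȳ) · 𝓔_y{S_i(ȳ)⁻¹·𝐔(y,x)·S_i(x)}` (definitional)
    show ‖((shearRIter av (fun _ => symContourData (federbushSU (n := Fin N))) (loopAvgBlockOp expMeanLogSU) U₁ i (emb y) *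
        loopAvgBlockOp expMeanLogSU i y (fun x =>
          (shearRIter av (fun _ => symContourData (federbushSU (n := Fin N))) (loopAvgBlockOp expMeanLogSU) U₁ i (emb y))⁻¹ *
            (symContourData (federbushSU (n := Fin N))).holTo (Averaging.iter av i U₁) y x *
            shearRIter av (fun _ => symContourData (federbushSU (n := Fin N))) (loopAvgBlockOp expMeanLogSU) U₁ i x) : SU N) : Matrix (Fin N) (Fin N) ℂ) - 1‖ ≤ s (i + 1)
    refine (norm_coe_mul_sub_one_le _ _).trans ((add_le_add (ih' (emb y) (hgood_emb i hi y hy)) ?_).trans (hss i hi))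
    -- the block operation: members within `t_i`, so `𝓔 ≤ 2t_i + 8t_i²`
    rw [loopAvgBlockOp_eq _ hiK]
    refine norm_coe_avg_sub_one_le _ (fun r => ?_) (ht2 i hi)
    -- one member: `‖S(ȳ)⁻¹·M(stairs)·S(x_r) − 1‖ = ‖M(stairs)·S(x_r) − S(ȳ)‖ ≤ 7σ + s + s`
    have hfam := familySmall_of_norm_le _ (hσ i hi y hy r) (hσδ i hi)
    rw [symContourData_holTo_of_small _ hiK _ y r hfam, norm_coe_inv_mul_mul_sub_one_eq]
    have hM := norm_coe_fedM_sub_one_le _ (hσ i hi y hy r) (hσδ i hi)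
    have hSx := ih' (Site.blockSite y r) (hgood_block i hi y hy r)
    have hSc := ih' (emb y) (hgood_emb i hi y hy)
    have h1 : (((federbushSU (n := Fin N)).M (stairFamily (Averaging.iter av i U₁) y r) *
          shearRIter av (fun _ => symContourData (federbushSU (n := Fin N))) (loopAvgBlockOp expMeanLogSU) U₁ i (Site.blockSite y r) : SU N) : Matrix (Fin N) (Fin N) ℂ) -
          ((shearRIter av (fun _ => symContourData (federbushSU (n := Fin N))) (loopAvgBlockOp expMeanLogSU) U₁ i (emb y) : SU N) : Matrix (Fin N) (Fin N) ℂ) =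
        ((((federbushSU (n := Fin N)).M (stairFamily (Averaging.iter av i U₁) y r) *
          shearRIter av (fun _ => symContourData (federbushSU (n := Fin N))) (loopAvgBlockOp expMeanLogSU) U₁ i (Site.blockSite y r) : SU N) : Matrix (Fin N) (Fin N) ℂ) - 1) -
        (((shearRIter av (fun _ => symContourData (federbushSU (n := Fin N))) (loopAvgBlockOp expMeanLogSU) U₁ i (emb y) : SU N) : Matrix (Fin N) (Fin N) ℂ) - 1) := by abel
    rw [h1]
    refine (norm_sub_le _ _).trans ?_
    have h2 := norm_coe_mul_sub_one_le ((federbushSU (n := Fin N)).M (stairFamily (Averaging.iter av i U₁) y r))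
      (shearRIter av (fun _ => symContourData (federbushSU (n := Fin N))) (loopAvgBlockOp expMeanLogSU) U₁ i (Site.blockSite y r))
    linarith [hst i hi]

/-- ★★★ **THE THREE LETTERS OF (L1″) FROM THE STAIR LETTER** — in the exact binder shapes of `…N07DbarFrameTowerBridge.norm_accFrame_sub_shearRIter_le`: for `i < l` at good sites `y` of
level `i+1` and every block offset `r`, (hfam) the stair family of `M^i(U₁)` is Federbush-small, (hP) every member is within `p_i := 8σ_i` of the mean, (hY) the sheared one-block family
`S_i(ȳ)⁻¹·𝐔(y,x_r)·S_i(x_r)` is within `t_i` of `1`. [cite: Balaban1985Averaging, (85) p.31, (110) p.34; Balaban1987RG1, (0.10)–(0.11) p.253] -/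
theorem sheared_family_letters (hl : l ≤ P.m + P.K)
    (hgood_emb : ∀ i, i < l → ∀ y : Site P (i + 1), good (i + 1) y → good i (emb y))
    (hgood_block : ∀ i, i < l → ∀ y : Site P (i + 1), good (i + 1) y → ∀ r : Fin P.d → Fin P.L, good i (Site.blockSite y r))
    (σ s t : ℕ → ℝ)
    (hσ : ∀ i, i < l → ∀ y : Site P (i + 1), good (i + 1) y → ∀ (r : Fin P.d → Fin P.L) (k : Fin ((Nat.factorial P.d - 1) + 1)),
      ‖((stairFamily (Averaging.iter av i U₁) y r k : SU N) : Matrix (Fin N) (Fin N) ℂ) - 1‖ ≤ σ i)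
    (hσδ : ∀ i, i < l → 2 * σ i < (federbushSU (n := Fin N)).δ)
    (hs0 : 0 ≤ s 0) (hst : ∀ i, i < l → 7 * σ i + 2 * s i ≤ t i) (ht2 : ∀ i, i < l → t i ≤ 1 / 2)
    (hss : ∀ i, i < l → s i + (2 * t i + 8 * t i ^ 2) ≤ s (i + 1)) :
    (∀ i, i < l → ∀ y : Site P (i + 1), good (i + 1) y → ∀ r : Fin P.d → Fin P.L,
      FamilySmall (federbushSU (n := Fin N)).δ (stairFamily (Averaging.iter av i U₁) y r)) ∧
    (∀ i, i < l → ∀ y : Site P (i + 1), good (i + 1) y → ∀ (r : Fin P.d → Fin P.L) (k : Fin ((Nat.factorial P.d - 1) + 1)),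
      ‖((stairFamily (Averaging.iter av i U₁) y r k : SU N) : Matrix (Fin N) (Fin N) ℂ) *
          star (((federbushSU (n := Fin N)).M (stairFamily (Averaging.iter av i U₁) y r) : SU N) : Matrix (Fin N) (Fin N) ℂ) - 1‖ ≤ 8 * σ i) ∧
    (∀ i, i < l → ∀ y : Site P (i + 1), good (i + 1) y → ∀ r : Fin P.d → Fin P.L,
      ‖((((shearRIter av (fun _ => symContourData (federbushSU (n := Fin N))) (loopAvgBlockOp expMeanLogSU) U₁ i (emb y))⁻¹ *
            (symContourData (federbushSU (n := Fin N))).holTo (Averaging.iter av i U₁) y (Site.blockSite y r) *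
            shearRIter av (fun _ => symContourData (federbushSU (n := Fin N))) (loopAvgBlockOp expMeanLogSU) U₁ i (Site.blockSite y r) : SU N)) : Matrix (Fin N) (Fin N) ℂ) - 1‖ ≤ t i) := by
  have hS := norm_shearRIter_sub_one_le av U₁ good l hl hgood_emb hgood_block σ s t hσ hσδ hs0 hst ht2 hss
  refine ⟨fun i hi y hy r => familySmall_of_norm_le _ (hσ i hi y hy r) (hσδ i hi),
    fun i hi y hy r k => norm_mul_star_fedM_sub_one_le _ (hσ i hi y hy r) (hσδ i hi) k, fun i hi y hy r => ?_⟩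
  have hiK : i + 1 ≤ P.m + P.K := (Nat.succ_le_of_lt hi).trans hl
  have hfam := familySmall_of_norm_le _ (hσ i hi y hy r) (hσδ i hi)
  rw [symContourData_holTo_of_small _ hiK _ y r hfam, norm_coe_inv_mul_mul_sub_one_eq]
  have hM := norm_coe_fedM_sub_one_le _ (hσ i hi y hy r) (hσδ i hi)
  have hSx := hS i hi.le (Site.blockSite y r) (hgood_block i hi y hy r)
  have hSc := hS i hi.le (emb y) (hgood_emb i hi y hy)
  have h1 : (((federbushSU (n := Fin N)).M (stairFamily (Averaging.iter av i U₁) y r) *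
        shearRIter av (fun _ => symContourData (federbushSU (n := Fin N))) (loopAvgBlockOp expMeanLogSU) U₁ i (Site.blockSite y r) : SU N) : Matrix (Fin N) (Fin N) ℂ) -
        ((shearRIter av (fun _ => symContourData (federbushSU (n := Fin N))) (loopAvgBlockOp expMeanLogSU) U₁ i (emb y) : SU N) : Matrix (Fin N) (Fin N) ℂ) =
      ((((federbushSU (n := Fin N)).M (stairFamily (Averaging.iter av i U₁) y r) *
        shearRIter av (fun _ => symContourData (federbushSU (n := Fin N))) (loopAvgBlockOp expMeanLogSU) U₁ i (Site.blockSite y r) : SU N) : Matrix (Fin N) (Fin N) ℂ) - 1) -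
      (((shearRIter av (fun _ => symContourData (federbushSU (n := Fin N))) (loopAvgBlockOp expMeanLogSU) U₁ i (emb y) : SU N) : Matrix (Fin N) (Fin N) ℂ) - 1) := by abel
  rw [h1]
  refine (norm_sub_le _ _).trans ?_
  have h2 := norm_coe_mul_sub_one_le ((federbushSU (n := Fin N)).M (stairFamily (Averaging.iter av i U₁) y r))
    (shearRIter av (fun _ => symContourData (federbushSU (n := Fin N))) (loopAvgBlockOp expMeanLogSU) U₁ i (Site.blockSite y r))
  linarith [hst i hi]

end Letters

end Summit.QuantumFields.YangMills.BalabanUVNodes.N07ShearedFrameLetters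

end
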